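import Summits.QuantumFields.BalabanUV.Beta.FP.RelInvPeriodisedChart
import Summits.QuantumFields.BalabanUV.Beta.RelInvCombShiftedSpread
import Summits.QuantumFields.BalabanUV.Beta.CombChartContactFactor

/-!
# `BalabanUV.Beta.FP.RelInvPeriodisedComb` — road «FP» (binder row D1), ROUTE T row **(T-INV)** AT THE CHART OF RECORD (III′), the (J-a)
# dictionary's item **(γ-sym)** (an2 g39 `JA-TABLE` §3 + the OWNER d1-p3 g19's located addition W-FP-19-23), LATTICE HALF + THE FOUR TORUS RULES:
# **THE CHART-(III′) TRIPLE `(Â′_j, 𝕄′_j, Ê) = (GcombSh Lc j, bhKStepSh d Lc (Dsh Lc) j, axEc ρ_c Lc)` IS A PERIODISABLE RELATIVE-INVERSE CHART**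
# — the seven lattice letters of `FP/RelInvPeriodisedChart` DISCHARGED for it (every `d`, every `Lc ≥ 1`, EVERY level `j`), and the four matrix
# rules ∕ the compression on every torus box `M` with `Lc ∣ M_i`

HONEST DEPENDENCY (page 1, mandatory): continuum YM on T⁴ ⇐ BetaPertH ∧ nine spine estimates (0/9 proved); BetaPertH ⇐ (D1) ∧ (D4) ∧
CAP+tail; G-an2-4 gates asym, D1 and NE2/3/4.  HONEST FRAMING (cell contract, verbatim): «discharging `BetaPertH` makes Bałaban's UV
stability UNCONDITIONAL — a real constructive-QFT result; it is NOT the continuum limit and NOT the Clay problem.»  ABSOLUTE RULE (cell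
charter, verbatim): «No internally-minted statement may enter as a cited fact. Every hypothesis is either kernel-proved in this package or a
verbatim quotation of a PUBLISHED theorem with page reference. The manuscript(s) under audit are NOT citable for their own disputed steps — they
are the thing under adjudication; programme-internal (2001/route/tribunal) claims are never citable.»

THE SEVEN LETTERS (the hypotheses `hA hMh hAt hMt hrel hmm hanti` of `RelInvPeriodisedChart`, here THEOREMS):
* (i) `RelInv Â′_j 𝕄′_j Ê` = an2's P2 `RelInvCombShiftedSpread.relInv_coDressKAt_Gsym_bhKStepSh` (BY NAME, `GcombSh_apply` is `rfl`); spread: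
  `CombChartContactFactor.spr_GcombSh`, `SymShiftedSpread.spr_bhKStepSh (DshAn1.spr_Dsh)`; `Lcℤ^{d+1}`-invariance: `CombChartStepJets.shiftK_GcombSh` and the NEW
  §1–§2 `SymLamAt_delta1_translate ∕ dz_lam04_translate ∕ shiftK_Dsh ∕ shiftK_bhKStep ∕ shiftK_bhKStepSh` (an1's symmetrised block potential of a bond
  indicator is block-translation covariant — `SymmetrisedAxialPotential.symAxial_add` + road BF-x's `delta1_add`; the straight step candidate by
  `D1BFx.SortedRelInv.shiftK_bhK` + `BalabanStepJetsSucc.shiftK_E2`, exactly as `RelInvPeriodised.shiftK_bhKStepAt`);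
* (ii) zero multiplier block: `E3ContactFactor.bhKStepSh_mm` at (Dmm) `DshAn1.Dsh_inr_inr`;
* (iii) antisymmetric borders: `trK 𝕄′_j = sgnK 𝕄′_j` at every level (leaf-03 g19's `CombChartSpreadBlind.trK_bhKSym` ∕ `trK_bhKStepSh_succ`), read entrywise;
* for the sequels: (iv) `Â′_j`'s multiplier block at the coarse points is `E2 (j+1)` on field legs (`CombChartContactFactor.mmRead_GcombSh`), (v) the
  level-`(j+1)` field block of `𝕄′` is `wVH (j+1) · E2 (j+1)` (`bhKStep_succ_inl_inl`, (Dff) `Dsh_inl_inl`).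
§4: the torus instances `perF_rules_comb`, `torus_relInv_compress_canonical_comb`, `perF_bhKStepSh_inr_inr`, `perF_bhKStepSh_inl_inr_eq_neg` (root offset
`ctrOff (d+1) Lc`; `ctr (d+1) Lc = toSite (ctrOff (d+1) Lc)` is `rfl`).  [folklore] bookkeeping BY NAME over an1's ∕ an2's ∕ leaf-03's landed modules;
nothing of theirs restated; no `Prop`, no `def`, nothing cited, 0 sorry; discharges NO binder of row D1; NOT (J-a), NOT (T-ID), NOT SDF, NOT D1, NOT
BetaPertH, NOT continuum, NOT Clay; 0 estimates.  Unit `b2b-balaban-beta-d1-formalise-leaf-05` (gen 29), 2026-08-22; no existing file touched.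
-/

noncomputable section

open scoped BigOperators Matrix

namespace Summit.QuantumFields.BalabanUV.Beta.FP.RelInvPeriodisedComb

open Matrix
open Literature.Probability.LatticeModels (Torus.proj)
open Literature.MathematicalPhysics.QuantumFieldTheory.LatticeForm (quo proj_add_zsmul)
open Literature.MathematicalPhysics.QuantumFieldTheory.Balaban1983to89
open Literature.MathematicalPhysics.QuantumFieldTheory.Balaban1983to89.Beta
open B4TorusKernel.MultiPeriod (translate)
open ExpKernelCalculus (MKer shiftK)
open AffineAveraging (Form0 Form1 Site box toSite unitVec dz)
open AveragingContours (shift)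
open AveragingContoursRooted (ctr ctrOff ctrOff_mem_box)
open KKTFluctuationKernel (delta1)
open OneStepResolventKernel (Fib)
open BalabanStepJetsSucc (E2 shiftK_E2 wVH mmRead mmRead_inl_inl)
open Summit.QuantumFields.BalabanUV.Beta.TameKernelCalculus (Spr trK trK_apply)
open Summit.QuantumFields.BalabanUV.Beta.ChartConjugationRelative (RelInv)
open Summit.QuantumFields.BalabanUV.Beta.AxialDressingRooted (axEc one_le_of_neZero)
open Summit.QuantumFields.BalabanUV.Beta.BorderedHessian (bhK bhK_inr_inr bhKStep bhKStep_zero bhKStep_succ_inl_inl bhKStep_succ_inl_inr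
  bhKStep_succ_inr_inl bhKStep_succ_inr_inr stepScale sgnK sgnK_apply sgnF_inl sgnF_inr)
open Summit.QuantumFields.BalabanUV.Beta.D1BFx.SortedRelInv (shiftK_bhK delta1_add)
open Summit.QuantumFields.BalabanUV.Beta.SymmetrisedAxialPotential (SymLamAt symAxial_add)
open Summit.QuantumFields.BalabanUV.Beta.SymmetrisedStepJets (Gsym)
open Summit.QuantumFields.BalabanUV.Beta.SymShiftedSpread (bhKStepSh bhKStepSh_apply bhKStepSh_zero spr_bhKStepSh)
open Summit.QuantumFields.BalabanUV.Beta.DshAn1 (lam04 Dsh Dsh_inl_inl Dsh_inr_inr Dsh_inl_inr Dsh_inr_inl spr_Dsh)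
open Summit.QuantumFields.BalabanUV.Beta.CombChartSpreadBlind (trK_bhKSym trK_bhKStepSh_succ)
open Summit.QuantumFields.BalabanUV.Beta.CombChartStepJets (GcombSh GcombSh_apply shiftK_GcombSh)
open Summit.QuantumFields.BalabanUV.Beta.CombChartContactFactor (spr_GcombSh mmRead_GcombSh)
open Summit.QuantumFields.BalabanUV.Beta.E3ContactFactor (bhKStepSh_mm)
open Summit.QuantumFields.BalabanUV.Beta.RelInvCombShiftedSpread (relInv_coDressKAt_Gsym_bhKStepSh)
open Summit.QuantumFields.BalabanUV.Beta.FP.KernelPeriodisationFib (Idx perF)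
open Summit.QuantumFields.BalabanUV.Beta.FP.RelInvPeriodisedChart (perF_inr_inr_of_mm perF_inl_inr_eq_neg_of_anti perF_rules_of_relInv
  torus_relInv_compress_canonical_of_relInv)

variable {d : ℕ}

/-! ## §1 an1's symmetrised block potential of a bond indicator is block-translation covariant -/

section Potential

/-- [folklore] **BLOCK-TRANSLATION COVARIANCE OF THE SYMMETRISED BLOCK POTENTIAL OF A BOND INDICATOR** (any root `ρ`): translating the fine bond by
`N•t` and the coarse argument by `t` does not change `SymLamAt ρ (δ_{(α,x)}) N` (`symAxial_add` + `delta1_add`). -/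
theorem SymLamAt_delta1_translate (ρ : Fin (d + 1) → ℤ) (N : ℕ) (α : Fin (d + 1)) (x Y t : Fin (d + 1) → ℤ) :
    SymLamAt ρ (delta1 α (x + (N : ℤ) • t)) N (Y + t) = SymLamAt ρ (delta1 α x) N Y := by
  have hsh : shift ((N : ℤ) • t) (delta1 α (x + (N : ℤ) • t)) = delta1 α x := by
    funext μ z
    rw [delta1_add]
    simp only [shift, add_sub_cancel_right]
  simp only [SymLamAt]
  refine Finset.sum_congr rfl fun b _ => ?_
  rw [show (N : ℤ) • (Y + t) + ρ = ((N : ℤ) • Y + ρ) + (N : ℤ) • t by rw [smul_add]; abel,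
    show (N : ℤ) • (Y + t) + toSite b = ((N : ℤ) • Y + toSite b) + (N : ℤ) • t by rw [smul_add]; abel, symAxial_add, hsh]

/-- [folklore] … hence so is the coarse gradient of an1's normalised potential `lam04`:
`dz (lam04 N α (x + N•t)) m (Y + t) = dz (lam04 N α x) m Y`. -/
theorem dz_lam04_translate (N : ℕ) (α m : Fin (d + 1)) (x Y t : Fin (d + 1) → ℤ) :
    dz (lam04 N α (x + (N : ℤ) • t)) m (Y + t) = dz (lam04 N α x) m Y := by
  simp only [dz, lam04]
  rw [show Y + t + unitVec m = (Y + unitVec m) + t by abel, SymLamAt_delta1_translate, SymLamAt_delta1_translate]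

end Potential

/-! ## §2 `Lcℤ^{d+1}`-invariance of an1's shift `Dsh`, of the straight step candidate, and of the legged border `𝕄′_j` -/

section Covariance

/-- [folklore] **an1's SYMMETRISED BORDER SHIFT IS BLOCK COVARIANT**: `shiftK (N•t) (Dsh N) = Dsh N` (`proj` and `quo` of a coarse translate, §1). -/
theorem shiftK_Dsh (N : ℕ) [NeZero N] (t : Fin (d + 1) → ℤ) : shiftK ((N : ℤ) • t) (Dsh (d := d) N) = Dsh N := by
  funext x y a b
  simp only [ExpKernelCalculus.shiftK]
  rcases a with α | m <;> rcases b with β | m'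
  · rw [Dsh_inl_inl, Dsh_inl_inl]
  · rw [Dsh_inl_inr, Dsh_inl_inr, proj_add_zsmul, D1BFx.SortedReblocking.quo_add_zsmul, dz_lam04_translate]
  · rw [Dsh_inr_inl, Dsh_inr_inl, proj_add_zsmul, D1BFx.SortedReblocking.quo_add_zsmul, dz_lam04_translate]
  · rw [Dsh_inr_inr, Dsh_inr_inr]

variable {Lc : ℕ} [NeZero Lc]

/-- [folklore] **THE STRAIGHT STEP CANDIDATE IS BLOCK COVARIANT**, every level: `shiftK (Lc•t) (bhKStep d Lc j) = bhKStep d Lc j` (`j = 0`: road BF-x's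
`shiftK_bhK`; `j + 1`: the field block `wVH·E2` by `shiftK_E2`, the borders `stepScale ·` those of `bhK`, the corner `0` — as `RelInvPeriodised.shiftK_bhKStepAt`). -/
theorem shiftK_bhKStep (t : Fin (d + 1) → ℤ) : ∀ j : ℕ, shiftK ((Lc : ℤ) • t) (bhKStep d Lc j) = bhKStep d Lc j
  | 0 => by rw [bhKStep_zero]; exact shiftK_bhK (N := Lc) t
  | j + 1 => by
    have hA := shiftK_bhK (d := d) (N := Lc) t
    have hE := shiftK_E2 (d := d) (Lc := Lc) (j + 1) ((Lc : ℤ) • t)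
    funext x y a b
    have hA' := congrFun (congrFun (congrFun (congrFun hA x) y) a) b
    have hE' := congrFun (congrFun (congrFun (congrFun hE x) y) a) b
    simp only [ExpKernelCalculus.shiftK] at hA' hE' ⊢
    rcases a with κ | κ <;> rcases b with l | l
    · rw [bhKStep_succ_inl_inl, bhKStep_succ_inl_inl, hE']
    · rw [bhKStep_succ_inl_inr, bhKStep_succ_inl_inr, hA']
    · rw [bhKStep_succ_inr_inl, bhKStep_succ_inr_inl, hA']
    · rw [bhKStep_succ_inr_inr, bhKStep_succ_inr_inr]

/-- [folklore] **THE LEGGED BORDER OF CHART (III′) IS BLOCK COVARIANT**, every level: `shiftK (Lc•t) (bhKStepSh d Lc (Dsh Lc) j) = bhKStepSh d Lc (Dsh Lc) j`. -/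
theorem shiftK_bhKStepSh (t : Fin (d + 1) → ℤ) (j : ℕ) :
    shiftK ((Lc : ℤ) • t) (bhKStepSh d Lc (Dsh Lc) j) = bhKStepSh d Lc (Dsh Lc) j := by
  have h1 := shiftK_bhKStep (d := d) (Lc := Lc) t j
  have h2 := shiftK_Dsh (d := d) Lc t
  funext x y a b
  have h1' := congrFun (congrFun (congrFun (congrFun h1 x) y) a) b
  have h2' := congrFun (congrFun (congrFun (congrFun h2 x) y) a) b
  simp only [ExpKernelCalculus.shiftK] at h1' h2' ⊢
  simp only [bhKStepSh_apply, Pi.add_apply, Pi.smul_apply, h1', h2']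

/-- [folklore] The comb-chart resolvent is block covariant, positive-translate form of an2's `shiftK_GcombSh`:
`shiftK (Lc•t) (GcombSh Lc j) = GcombSh Lc j`. -/
theorem shiftK_GcombSh' (j : ℕ) (t : Fin (d + 1) → ℤ) : shiftK ((Lc : ℤ) • t) (GcombSh (d := d) Lc j) = GcombSh (d := d) Lc j := by
  have h := shiftK_GcombSh (d := d) Lc j (-t)
  rwa [smul_neg, neg_neg] at h

end Covariance

/-! ## §3 The block letters of the legged border and of the comb-chart resolvent -/

section Blocks

variable {Lc : ℕ} [NeZero Lc]

/-- [folklore] **`trK 𝕄′_j = sgnK 𝕄′_j` AT EVERY LEVEL** (leaf-03 g19: `trK_bhKSym` at `j = 0` via `bhKStepSh_zero`, `trK_bhKStepSh_succ` at `j + 1`). -/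
theorem trK_bhKStepSh : ∀ j : ℕ, trK (bhKStepSh d Lc (Dsh Lc) j) = sgnK (bhKStepSh d Lc (Dsh Lc) j)
  | 0 => by rw [bhKStepSh_zero]; exact trK_bhKSym
  | j + 1 => trK_bhKStepSh_succ (d := d) (Lc := Lc) j

/-- [folklore] (ii) **THE MULTIPLIER BLOCK OF `𝕄′_j` VANISHES** (`E3ContactFactor.bhKStepSh_mm` at (Dmm) `Dsh_inr_inr`). -/
theorem bhKStepSh_inr_inr (j : ℕ) (x y : Fin (d + 1) → ℤ) (κ l : Fin (d + 1)) :
    bhKStepSh d Lc (Dsh Lc) j x y (Sum.inr κ) (Sum.inr l) = 0 :=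
  bhKStepSh_mm (Dsh := Dsh Lc) (fun x y κ l => Dsh_inr_inr Lc x y κ l) j x y κ l

/-- [folklore] (iii) **THE BORDERS OF `𝕄′_j` ARE ANTISYMMETRICALLY PLACED**: `𝕄′_j x y (inl κ) (inr l) = −𝕄′_j y x (inr l) (inl κ)` (the `(inr, inl)` entry of
`trK 𝕄′_j = sgnK 𝕄′_j`). -/
theorem bhKStepSh_inl_inr_eq_neg (j : ℕ) (x y : Fin (d + 1) → ℤ) (κ l : Fin (d + 1)) :
    bhKStepSh d Lc (Dsh Lc) j x y (Sum.inl κ) (Sum.inr l) = -bhKStepSh d Lc (Dsh Lc) j y x (Sum.inr l) (Sum.inl κ) := by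
  have h := congrFun (congrFun (congrFun (congrFun (trK_bhKStepSh (d := d) (Lc := Lc) j) y) x) (Sum.inr l)) (Sum.inl κ)
  rw [trK_apply, sgnK_apply, sgnF_inr, sgnF_inl] at h
  rw [h]
  ring

/-- [folklore] (iv) **THE MULTIPLIER BLOCK OF `Â′_j` AT THE COARSE POINTS IS `E2 (j+1)` ON FIELD LEGS**:
`GcombSh Lc j (Lc•x) (Lc•y) (inr m) (inr m') = E2 d Lc (j+1) x y (inl m) (inl m')` (`CombChartContactFactor.mmRead_GcombSh`, read entrywise). -/
theorem GcombSh_coarse_inr_inr_eq_E2 (j : ℕ) (x y : Fin (d + 1) → ℤ) (m m' : Fin (d + 1)) :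
    GcombSh (d := d) Lc j ((Lc : ℤ) • x) ((Lc : ℤ) • y) (Sum.inr m) (Sum.inr m') = E2 d Lc (j + 1) x y (Sum.inl m) (Sum.inl m') := by
  have h := congrFun (congrFun (congrFun (congrFun (mmRead_GcombSh (d := d) (Lc := Lc) j) x) y) (Sum.inl m)) (Sum.inl m')
  rwa [mmRead_inl_inl] at h

/-- [folklore] (v) **THE LEVEL-`(j+1)` FIELD BLOCK OF `𝕄′` IS `wVH (j+1) · E2 (j+1)`** ((Dff): the shift has no field–field block). -/
theorem bhKStepSh_succ_inl_inl (j : ℕ) (x y : Fin (d + 1) → ℤ) (κ l : Fin (d + 1)) :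
    bhKStepSh d Lc (Dsh Lc) (j + 1) x y (Sum.inl κ) (Sum.inl l) = wVH d Lc (j + 1) * E2 d Lc (j + 1) x y (Sum.inl κ) (Sum.inl l) := by
  rw [bhKStepSh_apply]
  simp only [Pi.add_apply, Pi.smul_apply, smul_eq_mul, bhKStep_succ_inl_inl, Dsh_inl_inl, mul_zero, add_zero]

/-- [folklore] (i) **THE RELATIVE INVERSE OF THE CHART-(III′) TRIPLE**, `GcombSh` spelling of an2's P2 (`GcombSh_apply` is `rfl`). -/
theorem relInv_GcombSh_bhKStepSh (j : ℕ) : RelInv (GcombSh (d := d) Lc j) (bhKStepSh d Lc (Dsh Lc) j) (axEc (ctr (d + 1) Lc) Lc) := by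
  rw [GcombSh_apply]
  exact relInv_coDressKAt_Gsym_bhKStepSh j

/-- [folklore] (i) spread of the legged border at an1's shift. -/
theorem spr_bhKStepSh_Dsh (j : ℕ) : Spr (bhKStepSh d Lc (Dsh Lc) j) := spr_bhKStepSh (spr_Dsh (one_le_of_neZero Lc)) j

end Blocks

/-! ## §4 The torus: the four matrix rules, the compression, the torus block letters of `M̂′ := perF M 𝕄′_j` -/

section Torus

variable {Lc : ℕ} [NeZero Lc] (M : Fin (d + 1) → ℕ) [∀ μ, NeZero (M μ)]

omit [∀ μ, NeZero (M μ)] in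
/-- [folklore] **THE PERIODISED MULTIPLIER–MULTIPLIER BLOCK OF `𝕄′_j` VANISHES** (every `j`, every box). -/
theorem perF_bhKStepSh_inr_inr (j : ℕ) (p q : Idx M (Fib d)) {κ l : Fin (d + 1)} (hp : p.2 = Sum.inr κ) (hq : q.2 = Sum.inr l) :
    perF M (bhKStepSh d Lc (Dsh Lc) j) p q = 0 :=
  perF_inr_inr_of_mm M (bhKStepSh_inr_inr (d := d) (Lc := Lc) j) p q hp hq

omit [∀ μ, NeZero (M μ)] in
/-- [folklore] **THE PERIODISED BORDERS OF `𝕄′_j` ARE NEGATIVE-TRANSPOSED** (every `j`, every box `M` with `Lc ∣ M_i`). -/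
theorem perF_bhKStepSh_inl_inr_eq_neg (hM : ∀ i, Lc ∣ M i) (j : ℕ) (p q : Idx M (Fib d)) {κ l : Fin (d + 1)}
    (hp : p.2 = Sum.inl κ) (hq : q.2 = Sum.inr l) :
    perF M (bhKStepSh d Lc (Dsh Lc) j) p q = -perF M (bhKStepSh d Lc (Dsh Lc) j) q p :=
  perF_inl_inr_eq_neg_of_anti M hM (fun t => shiftK_bhKStepSh (d := d) (Lc := Lc) t j) (bhKStepSh_inl_inr_eq_neg (d := d) (Lc := Lc) j) p q hp hq

/-- **[folklore] THE FOUR MATRIX RULES ON THE TORUS BOX FOR CHART (III′)**, every level `j`, every box `M` with `Lc ∣ M_i`: with `Ê := perF M (axEc ρ_c Lc)`,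
`Â′ := perF M (GcombSh Lc j)`, `M̂′ := perF M (bhKStepSh d Lc (Dsh Lc) j)`: `Ê·Â′ = Â′`, `Â′·Ê = Â′`, `Â′·M̂′·Ê = Ê`, `Ê·M̂′·Â′ = Ê`
(`RelInvPeriodisedChart.perF_rules_of_relInv` at the seven letters of §2–§3). -/
theorem perF_rules_comb (hM : ∀ i, Lc ∣ M i) (j : ℕ) :
    perF M (axEc (ctr (d + 1) Lc) Lc) * perF M (GcombSh (d := d) Lc j) = perF M (GcombSh (d := d) Lc j)
      ∧ perF M (GcombSh (d := d) Lc j) * perF M (axEc (ctr (d + 1) Lc) Lc) = perF M (GcombSh (d := d) Lc j)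
      ∧ perF M (GcombSh (d := d) Lc j) * perF M (bhKStepSh d Lc (Dsh Lc) j) * perF M (axEc (ctr (d + 1) Lc) Lc)
        = perF M (axEc (ctr (d + 1) Lc) Lc)
      ∧ perF M (axEc (ctr (d + 1) Lc) Lc) * perF M (bhKStepSh d Lc (Dsh Lc) j) * perF M (GcombSh (d := d) Lc j)
        = perF M (axEc (ctr (d + 1) Lc) Lc) :=
  perF_rules_of_relInv M (ctr (d + 1) Lc) hM (spr_GcombSh j) (spr_bhKStepSh_Dsh j) (shiftK_GcombSh' j)
    (fun t => shiftK_bhKStepSh t j) (relInv_GcombSh_bhKStepSh j)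

open Classical in
/-- **[folklore] (T-INV) ON THE TORUS FOR CHART (III′), CANONICAL SORTING**: the LIVE BLOCK (live set read off `Ê`) of the periodised legged border
`perF M (bhKStepSh d Lc (Dsh Lc) j)` has a unit determinant and its inverse is the live block of the periodised comb-chart resolvent `perF M (GcombSh Lc j)`. -/
theorem torus_relInv_compress_canonical_comb (hM : ∀ i, Lc ∣ M i) (j : ℕ) :
    IsUnit (((perF M (bhKStepSh d Lc (Dsh Lc) j)).submatrix
        (Equiv.sumCompl fun p : Idx M (Fib d) => axEc (ctr (d + 1) Lc) Lc p.1 p.1 p.2 p.2 = 1)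
        (Equiv.sumCompl fun p : Idx M (Fib d) => axEc (ctr (d + 1) Lc) Lc p.1 p.1 p.2 p.2 = 1)).toBlocks₁₁).det
      ∧ (((perF M (bhKStepSh d Lc (Dsh Lc) j)).submatrix
          (Equiv.sumCompl fun p : Idx M (Fib d) => axEc (ctr (d + 1) Lc) Lc p.1 p.1 p.2 p.2 = 1)
          (Equiv.sumCompl fun p : Idx M (Fib d) => axEc (ctr (d + 1) Lc) Lc p.1 p.1 p.2 p.2 = 1)).toBlocks₁₁)⁻¹
          = ((perF M (GcombSh (d := d) Lc j)).submatrix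
              (Equiv.sumCompl fun p : Idx M (Fib d) => axEc (ctr (d + 1) Lc) Lc p.1 p.1 p.2 p.2 = 1)
              (Equiv.sumCompl fun p : Idx M (Fib d) => axEc (ctr (d + 1) Lc) Lc p.1 p.1 p.2 p.2 = 1)).toBlocks₁₁ :=
  torus_relInv_compress_canonical_of_relInv M (ctr (d + 1) Lc) hM (spr_GcombSh j) (spr_bhKStepSh_Dsh j) (shiftK_GcombSh' j)
    (fun t => shiftK_bhKStepSh t j) (relInv_GcombSh_bhKStepSh j)

end Torus

end Summit.QuantumFields.BalabanUV.Beta.FP.RelInvPeriodisedComb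

end
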